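/-
Copyright (c) 2026 the pub-hodgecm-mathlib formalisation cell (harness21).  Prover seat hodgecm-mathlib-K2Liu-p07 (g2): Track B «K2-LIT»,
#184♮ = hLiu418 = stmt-HodgeConjecture-24832, LEAD F0P6-plan (g10) DEAL 2026-09-03T22:32:11Z «O41.6» (organ of socket #41
`sig_K2LiuSiegelEisensteinContinuation`, U6 ED. 1 f3355952b3f59b83; steward K2Liu-p01 (g0), REPORT-FIRST #41 3813d253b69f799f §3 row O41.6);
REPORT-FIRST O41.6 `K2/K2Liu-p07/g2/REPORT-FIRST-O41_6-SiegelIntertwiningScalarGL1.K2Liup07g2.md` 4fa8c8febe08a2c2; 2026-09-03.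
-/
import Summits.HodgeConjecture.HodgeConjecture.Theorems.F0P2wPartialDedekindZetaPole
import Literature.NumberTheory.Automorphic.PairLFunctionPolesGLOneBoundaryUnconditional
import Literature.RepresentationTheory.HarrisKudlaSweet1996.GlobalSplittingCharacters
import Literature.NumberTheory.Automorphic.AutomorphicTwist
import HarnessLib

/-!
# Crux `HLiu418`, road `K2_Liu`, organ O41.6 of socket #41: the GL₁ scalar `a^S(s)/b^S(s)` of the Siegel intertwining
# operator of `U(2,2)` under parity — continuation to `Re s > 0` with at most a simple pole at `s = ½`

Cell `hodgecm-mathlib`, crux item hLiu418 = `stmt-HodgeConjecture-24832`, route `HCCMUnconditional`; squad K2 ∕ K2Liu, LEAD F0P6-plan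
(g10), planner K2Liu-plan (g0), #41 steward K2Liu-p01 (g0), prover K2Liu-p07 (g2).  THEOREMS ONLY (no `def`, no instance, no notation,
no named-fact hypothesis, no `sorry`, default heartbeats); lane `--supports stmt-HodgeConjecture-24832` (count-neutral helper).

THE OBJECT.  For `H = U(n,n)` of the CM extension `L/L⁺`, Siegel parabolic `P_Δ` (Levi `Res_{L/L⁺} GL_n`), and the degenerate principal
series `I_n(s,χ) = Ind(χ∘det_Δ · |det_Δ|_L^{s+n/2})` of a unitary Hecke character `χ` of `L`, the intertwining operator acts on the
spherical vector at an unramified `v` by the Gindikin–Karpelevich scalar `M_v(s) f°_s = (a_v(s)/b_v(s)) f°_{−s}`,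
  `b_n(s,χ) = ∏_{r=0}^{n−1} L(2s + n − r, χ⁰ ε^r)`,   `a_n(s,χ) = ∏_{r=0}^{n−1} L(2s − r, χ⁰ ε^{n−1−r})`,   `χ⁰ = χ|_{𝔸_{L⁺}^×}`, `ε = ε_{L/L⁺}`,
so `M(s) = (a^S(s)/b^S(s)) ⊗_{v∈S} M_v(s)` [Harris2007 (1.3.4) p. 92, p. 99: `d_n^S(χ,s) = ∏_{r<n} L^S(2s+n−r, ε^{n−1+r})` for his
`χ|_𝔸 = ε^{n+1}`; Liu2011 (2-2): `b_m(s) = ∏_{i<m} L(2s+m−i, ε^i)` for `χ⁰ = 1`; KudlaSweet1997; Tan1999 §3].  At `n = 2`: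
`a(s) = L(2s, χ⁰ε)·L(2s−1, χ⁰)`, `b(s) = L(2s+2, χ⁰)·L(2s+1, χ⁰ε)`; under the PARITY of the K2_Liu frame (`χ` conjugate-symplectic,
`χ⁰ = ε`; REPORT-FIRST #41 (B4), LEAD RULING 22:32:11Z):  **`a(s) = ζ_{L⁺}(2s)·L(2s−1, ε)`,  `b(s) = ζ_{L⁺}(2s+1)·L(2s+2, ε)`.**
(Index check, REPORT-FIRST O41.6 §1: GK at an inert place — roots `2e₁, 2e₂` with torus character `χ⁰`, `e₁+e₂` with `χ⁰∘N_{L/L⁺}`,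
`L_{L_v}(z, χ⁰∘N) = L(z,χ⁰)L(z,χ⁰ε)` — and at a split place; Tan's pole set `(n−δ−2r)/2` [Harris2007 (1.2.5)]: `χ⁰ = 1 ⇒ s = 1` from
`ζ(2s−1)`, `χ⁰ = ε ⇒ s = ½` from `ζ(2s)`.)

WHAT IS PROVED — pure GL₁ analysis, for ANY number field `F` (read `L⁺`), ANY unitary Hecke character `ε ≠ 1` of `F` trivial on the
diagonal positive reals, `S` a FINITE set of finite places off which `ε` is unramified; with the tree's ★ `partialStandardL`:
`ζ_F^S(w) = partialStandardL S (fun _ => {1}) w`, `L^S(w, ε) = partialStandardL S (fun v => {ε(ϖ_v)}) w`,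
`a^S(s) = ζ_F^S(2s)·L^S(2s−1, ε)`, `b^S(s) = ζ_F^S(2s+1)·L^S(2s+2, ε)`.
* §2 (`Re s > 1`): `a^S`, `b^S` as `HasProd`-values, `≠ 0`; **`hasProd_localScalar`**: the Euler product over `v ∉ S` of the LOCAL scalars
  `[(1 − q_v^{−(2s+1)})(1 − ε_v q_v^{−(2s+2)})]/[(1 − q_v^{−2s})(1 − ε_v q_v^{−(2s−1)})]` converges to `a^S/b^S` — junction with O41.5.
* §3 **`differentiableOn_b`** (with `hasProd_b`): `b^S` is holomorphic and zero-free on the open half-plane `Re s > 0`.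
* §4 **`exists_entire_sub_half_mul_a`**: `(s − ½)·a^S(s) = A(s)` on `Re s > 1` with `A` ENTIRE (`L^S(·, ε)` entire for `ε ≠ 1`, ★
  `exists_entire_forall_ne_zero_eq_partialHeckeL`; `(w − 1)ζ_F^S(w)` entire, ★ `F0P2wPartialDedekindZetaPole.differentiableOn_update_sub_one_mul`).
* §5 MAIN **`exists_differentiableOn_sub_half_mul_scalar`**: `∃ G` HOLOMORPHIC ON `{Re s > 0}` with **`(s − ½)·(a^S(s)/b^S(s)) = G(s)`
  for `Re s > 1`** — the scalar continues meromorphically to `Re s > 0` with AT MOST a simple pole at `½` and no other singularity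
  (pole-free form, as #41's `P`-form with `P = {½}`).  «At most» is honest: the residue carries `L^S(0, ε)`, which vanishes as soon as
  `S` contains a place with `ε(ϖ_v) = 1`.
* §6 **`exists_continuation_b_boundary`** (the LEAD's «`b^S ≠ 0` on `Re s ≥ 0`»): `B(s) = ζ_F(2s+1)E_S(2s+1)L^S(2s+2, ε)` is holomorphic
  on `{Re s > −½} ∖ {0}`, equals `b^S` on `Re s > 0`, has NO ZERO on `Re s ≥ 0`, `s ≠ 0` (Landau), and `s·B(s) → r ≠ 0` at `s = 0`
  («the harmless pole of `ζ` making `1/b` vanish», #41 docstring).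
* §7 **CM COROLLARIES `…_cm`**: §5/§6 for `ε = ε_{L/L⁺} =` ★ `quadraticHeckeCharCM L`, `F = L⁺` — `ε ≠ 1` (★ `quadraticHeckeCharCM_ne_one`),
  finite order (★ `isFiniteOrder_quadraticHeckeCharCM`) hence unitary and trivial on `ℝ_{>0}` (★ `map_posRealIdele_of_isFiniteOrder`).
HOW #41 USES IT (organ O41.8): poles of `E^Δ(·; f_s)` on `Re s > 0` lie among those of the constant term `f_s + E₁(s) + M(s)f_s`,
`M(s)f_s = (a^S/b^S)(s)·⊗_{v∈S} M_v(s)f_{s,v}`, and §5 makes `(s − ½)·(a^S/b^S)` holomorphic on `Re s > 0`.  Not here (not needed under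
(B4)): the non-parity case `χ⁰ = 1` (extra pole at `s = 1`) and norm-twisted `χ⁰`.
HONEST LABEL.  Count-neutral helper; it retires nothing by itself: `HC_CM` is proved only modulo the 7 printed citations (2 remaining
named inputs: hLiu418 = `stmt-HodgeConjecture-24832`, h413 = `stmt-HodgeConjecture-24833`) until rung 0 closes.

## References
* [Harris2007] M. Harris, *Cohomological automorphic forms on unitary groups, II*, in: Harmonic Analysis, Group Representations,
  Automorphic Forms and Invariant Theory (Howe volume), World Scientific (2007): (1.2.5) p. 91, (1.3.4) p. 92, p. 99.
* [Liu2011] Y. Liu, *Arithmetic theta lifting and L-derivatives for unitary groups, I*, Algebra Number Theory 5 (2011): §2A (2-2).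
* [KudlaSweet1997] S. Kudla, W. J. Sweet, *Degenerate principal series representations for U(n,n)*, Israel J. Math. 98 (1997).
* [Tan1999] V. Tan, *Poles of Siegel Eisenstein series on U(n,n)*, Canad. J. Math. 51 (1999) 164–175: §3.
* [NeukirchANT1999] J. Neukirch, *Algebraic Number Theory* (1999): Ch. VII (5.2), Cor. (5.11), §8.
* [Iwasawa2019] K. Iwasawa, *Hecke's L-functions* (Princeton 1964), SpringerBriefs (2019): Thm. 3.1, Prop. 4.4.
-/

set_option autoImplicit false
set_option linter.dupNamespace false -- the mandated namespace repeats `HodgeConjecture.HodgeConjecture`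

noncomputable section

open scoped NNReal
open Filter Topology Complex NumberField IsDedekindDomain
open Literature.NumberTheory.Automorphic Literature.NumberTheory.LFunctions Literature.NumberTheory.GaloisRepresentations

namespace Summit.HodgeConjecture.HodgeConjecture.Cruxes.HLiu418.K2LiuSiegelIntertwiningScalarGL1

open Summit.HodgeConjecture.HodgeConjecture.Cruxes.H413.F0P2wPartialDedekindZetaPole

variable {F : Type} [Field F] [NumberField F]

/-! ## §1 Bookkeeping: real parts of `2s`, `2s − 1`, `2s + 1`, `2s + 2`; `‖ε(ϖ_v)‖ ≤ 1` -/

/-- `re (2s) = 2 re s`, `re (2s−1) = 2 re s − 1`, `re (2s+1) = 2 re s + 1`, `re (2s+2) = 2 re s + 2`. [folklore] -/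
theorem re_two_mul_shifts (s : ℂ) :
    (2 * s).re = 2 * s.re ∧ (2 * s - 1).re = 2 * s.re - 1 ∧ (2 * s + 1).re = 2 * s.re + 1 ∧ (2 * s + 2).re = 2 * s.re + 2 := by
  simp [Complex.mul_re]

/-- A unitary Hecke character has `‖ε(ϖ_v)‖ ≤ 1` (indeed `= 1`, ★ `norm_valueAtUniformizer_of_isUnitary`) — the coefficient bound under
which ★ `partialStandardL S (v ↦ {ε(ϖ_v)})` is an absolutely convergent Euler product on `Re > 1`. [cite: NeukirchANT1999, Ch. VII §8 (8.1)] -/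
theorem norm_valueAtUniformizer_le_one {ε : HeckeCharacter F} (hε : ε.IsUnitary) (S : Set (HeightOneSpectrum (𝓞 F))) :
    ∀ v : HeightOneSpectrum (𝓞 F), v ∉ S → ‖ε.valueAtUniformizer v‖ ≤ 1 :=
  fun v _ => (HeckeCharacter.norm_valueAtUniformizer_of_isUnitary hε v).le

/-! ## §2 Euler products on `Re s > 1`: `a^S`, `b^S`, and the product of the local Gindikin–Karpelevich scalars -/

section GL1

variable {ε : HeckeCharacter F} {S : Set (HeightOneSpectrum (𝓞 F))}

/-- **`a^S(s) = ζ_F^S(2s) · L^S(2s−1, ε)` as an Euler product, `Re s > 1`**: `∏'_{v∉S} (1 − q_v^{−2s})⁻¹(1 − ε(ϖ_v) q_v^{−(2s−1)})⁻¹`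
`HasProd`-converges to it and it is `≠ 0` (★ `hasProd_partialDedekindZeta` at `2s`, ★ `hasProd_partialStandardL_singleton` at `2s − 1`). [folklore] -/
theorem hasProd_a (hε : ε.IsUnitary) {s : ℂ} (hs : 1 < s.re) :
    HasProd (fun v : {v : HeightOneSpectrum (𝓞 F) // v ∉ S} =>
        (1 - (v.1.residueCard : ℂ) ^ (-(2 * s)))⁻¹ * (1 - ε.valueAtUniformizer v.1 * (v.1.residueCard : ℂ) ^ (-(2 * s - 1)))⁻¹)
      (partialStandardL S (fun _ => {1}) (2 * s) * partialStandardL S (fun v => {ε.valueAtUniformizer v}) (2 * s - 1)) ∧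
    partialStandardL S (fun _ => {1}) (2 * s) * partialStandardL S (fun v => {ε.valueAtUniformizer v}) (2 * s - 1) ≠ 0 := by
  obtain ⟨h2, h2m1, -, -⟩ := re_two_mul_shifts s
  have hζ := hasProd_partialDedekindZeta (S := S) (s := 2 * s) (by rw [h2]; linarith)
  have hL := hasProd_partialStandardL_singleton (S := S) (fun v => ε.valueAtUniformizer v)
    (norm_valueAtUniformizer_le_one hε S) (s := 2 * s - 1) (by rw [h2m1]; linarith)
  exact ⟨hζ.1.mul hL.1, mul_ne_zero hζ.2 hL.2⟩

/-- **`b^S(s) = ζ_F^S(2s+1) · L^S(2s+2, ε)` as an Euler product, `Re s > 0`** (so a fortiori on `Re s > 1`): `HasProd` and `≠ 0`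
(★ `hasProd_partialDedekindZeta` at `2s + 1`, ★ `hasProd_partialStandardL_singleton` at `2s + 2`). [folklore] -/
theorem hasProd_b (hε : ε.IsUnitary) {s : ℂ} (hs : 0 < s.re) :
    HasProd (fun v : {v : HeightOneSpectrum (𝓞 F) // v ∉ S} =>
        (1 - (v.1.residueCard : ℂ) ^ (-(2 * s + 1)))⁻¹ * (1 - ε.valueAtUniformizer v.1 * (v.1.residueCard : ℂ) ^ (-(2 * s + 2)))⁻¹)
      (partialStandardL S (fun _ => {1}) (2 * s + 1) * partialStandardL S (fun v => {ε.valueAtUniformizer v}) (2 * s + 2)) ∧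
    partialStandardL S (fun _ => {1}) (2 * s + 1) * partialStandardL S (fun v => {ε.valueAtUniformizer v}) (2 * s + 2) ≠ 0 := by
  obtain ⟨-, -, h2p1, h2p2⟩ := re_two_mul_shifts s
  have hζ := hasProd_partialDedekindZeta (S := S) (s := 2 * s + 1) (by rw [h2p1]; linarith)
  have hL := hasProd_partialStandardL_singleton (S := S) (fun v => ε.valueAtUniformizer v)
    (norm_valueAtUniformizer_le_one hε S) (s := 2 * s + 2) (by rw [h2p2]; linarith)
  exact ⟨hζ.1.mul hL.1, mul_ne_zero hζ.2 hL.2⟩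

/-- **JUNCTION WITH O41.5: the Euler product of the LOCAL Gindikin–Karpelevich scalars is `a^S(s)/b^S(s)`** (`Re s > 1`).  At an unramified
`v ∉ S` the spherical scalar of `M_v(s)` for `U(2,2)`, `χ⁰_v = ε_v`, is
`c_v(s) = L_v(2s,1)L_v(2s−1,ε_v) / (L_v(2s+1,1)L_v(2s+2,ε_v)) = [(1 − q_v^{−(2s+1)})(1 − ε_v q_v^{−(2s+2)})] / [(1 − q_v^{−2s})(1 − ε_v q_v^{−(2s−1)})]`
and `∏'_{v∉S} c_v(s)` `HasProd`-converges to `a^S(s)/b^S(s)` (`hasProd_a` times the inverse of `hasProd_b`, `Finset.prod_inv_distrib`).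
[cite: Harris2007, (1.3.4) p. 92] [cite: Liu2011, §2A (2-2)] -/
theorem hasProd_localScalar (hε : ε.IsUnitary) {s : ℂ} (hs : 1 < s.re) :
    HasProd (fun v : {v : HeightOneSpectrum (𝓞 F) // v ∉ S} =>
        ((1 - (v.1.residueCard : ℂ) ^ (-(2 * s + 1))) * (1 - ε.valueAtUniformizer v.1 * (v.1.residueCard : ℂ) ^ (-(2 * s + 2)))) /
          ((1 - (v.1.residueCard : ℂ) ^ (-(2 * s))) * (1 - ε.valueAtUniformizer v.1 * (v.1.residueCard : ℂ) ^ (-(2 * s - 1)))))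
      ((partialStandardL S (fun _ => {1}) (2 * s) * partialStandardL S (fun v => {ε.valueAtUniformizer v}) (2 * s - 1)) /
        (partialStandardL S (fun _ => {1}) (2 * s + 1) * partialStandardL S (fun v => {ε.valueAtUniformizer v}) (2 * s + 2))) := by
  obtain ⟨ha, -⟩ := hasProd_a (S := S) hε hs
  obtain ⟨hb, hb0⟩ := hasProd_b (S := S) hε (zero_lt_one.trans hs)
  -- invert the `b`-product
  have hbinv : HasProd (fun v : {v : HeightOneSpectrum (𝓞 F) // v ∉ S} =>
      ((1 - (v.1.residueCard : ℂ) ^ (-(2 * s + 1)))⁻¹ *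
        (1 - ε.valueAtUniformizer v.1 * (v.1.residueCard : ℂ) ^ (-(2 * s + 2)))⁻¹)⁻¹)
      (partialStandardL S (fun _ => {1}) (2 * s + 1) * partialStandardL S (fun v => {ε.valueAtUniformizer v}) (2 * s + 2))⁻¹ := by
    unfold HasProd at hb ⊢
    simpa only [Finset.prod_inv_distrib] using hb.inv₀ hb0
  refine (ha.mul hbinv).congr_fun fun v => ?_
  simp only [mul_inv, inv_inv, div_eq_mul_inv]
  ring

/-! ## §3 `b^S` on the open half-plane `Re s > 0`: holomorphic and zero-free -/

/-- **`b^S` is holomorphic on `{Re s > 0}`** (`ζ_F^S` at `2s + 1` and `L^S(·, ε)` at `2s + 2` are holomorphic on `Re > 1`: ★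
`differentiableOn_partialDedekindZeta`, ★ `differentiableOn_partialStandardL_singleton`, composed with the affine maps). [folklore] -/
theorem differentiableOn_b (hε : ε.IsUnitary) :
    DifferentiableOn ℂ (fun s : ℂ =>
      partialStandardL S (fun _ => {1}) (2 * s + 1) * partialStandardL S (fun v => {ε.valueAtUniformizer v}) (2 * s + 2))
      {s : ℂ | 0 < s.re} := by
  have h1 : DifferentiableOn ℂ (fun s : ℂ => partialStandardL S (fun _ => ({1} : Multiset ℂ)) (2 * s + 1)) {s : ℂ | 0 < s.re} :=
    differentiableOn_partialDedekindZeta.comp (((differentiableOn_const _).mul differentiableOn_id).add (differentiableOn_const _))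
      fun s hs => by
        have hs' : 0 < s.re := hs
        show 1 < (2 * s + 1).re
        rw [(re_two_mul_shifts s).2.2.1]; linarith
  have h2 : DifferentiableOn ℂ (fun s : ℂ => partialStandardL S (fun v => {ε.valueAtUniformizer v}) (2 * s + 2)) {s : ℂ | 0 < s.re} :=
    (differentiableOn_partialStandardL_singleton _ (norm_valueAtUniformizer_le_one hε S)).comp
      (((differentiableOn_const _).mul differentiableOn_id).add (differentiableOn_const _))
      fun s hs => by
        have hs' : 0 < s.re := hs
        show 1 < (2 * s + 2).re
        rw [(re_two_mul_shifts s).2.2.2]; linarith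
  exact h1.mul h2

/-! ## §4 The numerator: `(s − ½) · a^S(s)` is the restriction of an ENTIRE function -/

/-- **`(w − 1) · ζ_F^S(w)` is entire** (finite `S`): `(w − 1)·ζ_F(w)·E_S(w)`, `E_S(w) = ∏'_{v∈S}(1 − q_v^{−w})`, extended by `ρ_F·E_S(1)` at
`w = 1`, is differentiable everywhere (★ `differentiableOn_update_sub_one_mul` on `Re w > σ₀` for EVERY `σ₀ < 1`, a finite `S` being thin at
every exponent) and equals `(w − 1)·ζ_F^S(w)` for `Re w > 1` (★ `partialDedekindZeta_eq_dedekindZetaCont_mul`). [cite: NeukirchANT1999, Ch. VII Cor. (5.11)] -/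
theorem differentiable_update_sub_one_mul_zeta (hS : S.Finite) :
    Differentiable ℂ (Function.update (fun w : ℂ => (w - 1) *
        (dedekindZetaCont F w * ∏' v : S, (1 - ((v : HeightOneSpectrum (𝓞 F)).residueCard : ℂ) ^ (-w))))
        1 ((dedekindZeta_residue F : ℂ) * ∏' v : S, (1 - ((v : HeightOneSpectrum (𝓞 F)).residueCard : ℂ) ^ (-(1 : ℂ))))) ∧
    ∀ w : ℂ, 1 < w.re → Function.update (fun w : ℂ => (w - 1) *
        (dedekindZetaCont F w * ∏' v : S, (1 - ((v : HeightOneSpectrum (𝓞 F)).residueCard : ℂ) ^ (-w))))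
        1 ((dedekindZeta_residue F : ℂ) * ∏' v : S, (1 - ((v : HeightOneSpectrum (𝓞 F)).residueCard : ℂ) ^ (-(1 : ℂ)))) w =
      (w - 1) * partialStandardL S (fun _ => {1}) w := by
  refine ⟨fun w => ?_, fun w hw => ?_⟩
  · -- differentiable at `w`: use the half-plane `Re > σ₀` with `σ₀ = min (re w - 1) 0 < 1`
    set σ₀ : ℝ := min (w.re - 1) 0 with hσ₀
    have hσ₁ : σ₀ < 1 := (min_le_right _ _).trans_lt zero_lt_one
    have hmem : w ∈ {z : ℂ | σ₀ < z.re} := by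
      show σ₀ < w.re
      have : σ₀ ≤ w.re - 1 := min_le_left _ _
      linarith
    exact (differentiableOn_update_sub_one_mul (summable_residueCard_rpow_neg_of_finite hS σ₀) hσ₁).differentiableAt
      ((isOpen_lt continuous_const continuous_re).mem_nhds hmem)
  · have hne : w ≠ 1 := fun h => by rw [h, one_re] at hw; exact lt_irrefl _ hw
    rw [Function.update_of_ne hne,
      partialDedekindZeta_eq_dedekindZetaCont_mul (summable_residueCard_rpow_neg_of_finite hS 0) hw (zero_lt_one.trans hw)]

/-- **`L^S(w, ε)` is entire for `ε ≠ 1`** (unitary, trivial on `ℝ_{>0}`, unramified off the finite `S`): Hecke's theorem in the tree's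
unconditional form ★ `exists_entire_forall_ne_zero_eq_partialHeckeL` (Godement–Jacquet in rank one), respelled with ★ `partialStandardL`
(`eval_eulerPolynomial_singleton`). [cite: Iwasawa2019, Thm. 3.1] -/
theorem exists_entire_eq_partialL (hε : ε.IsUnitary) (hA : ∀ t : ℝ≥0ˣ, ε (posRealIdele F t) = 1) (h1 : ε ≠ 1)
    (hS : S.Finite) (hur : ∀ v ∉ S, ε.IsUnramifiedAt v) :
    ∃ g : ℂ → ℂ, Differentiable ℂ g ∧ (∀ w : ℂ, w.re = 1 → g w ≠ 0) ∧
      ∀ w : ℂ, 1 < w.re → partialStandardL S (fun v => {ε.valueAtUniformizer v}) w = g w := by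
  obtain ⟨g, hg, hg1, hg_eq⟩ := exists_entire_forall_ne_zero_eq_partialHeckeL ε hε hA h1 hS hur
  refine ⟨g, hg, hg1, fun w hw => ?_⟩
  rw [hg_eq w hw]
  unfold partialStandardL
  exact tprod_congr fun v => by rw [eval_eulerPolynomial_singleton]

/-- **THE NUMERATOR, POLE-FREE: `(s − ½) · a^S(s) = A(s)` on `Re s > 1` with `A` ENTIRE**, `A(s) = ½·[(w − 1)ζ_F(w)E_S(w)]_{w = 2s} · g(2s − 1)`,
`g` the entire continuation of `L^S(·, ε)`: `a^S` continues meromorphically to `ℂ` with at most a simple pole at `s = ½` (from `ζ_F(2s)`);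
`L(2s−1, ε)` contributes no pole. [cite: Tan1999, §3] [cite: NeukirchANT1999, Ch. VII Cor. (5.11)] [cite: Iwasawa2019, Thm. 3.1] -/
theorem exists_entire_sub_half_mul_a (hε : ε.IsUnitary) (hA : ∀ t : ℝ≥0ˣ, ε (posRealIdele F t) = 1) (h1 : ε ≠ 1)
    (hS : S.Finite) (hur : ∀ v ∉ S, ε.IsUnramifiedAt v) :
    ∃ A : ℂ → ℂ, Differentiable ℂ A ∧ ∀ s : ℂ, 1 < s.re →
      (s - 1 / 2) * (partialStandardL S (fun _ => {1}) (2 * s) * partialStandardL S (fun v => {ε.valueAtUniformizer v}) (2 * s - 1)) =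
        A s := by
  obtain ⟨hZ, hZ_eq⟩ := differentiable_update_sub_one_mul_zeta (F := F) hS
  set Z : ℂ → ℂ := Function.update (fun w : ℂ => (w - 1) *
        (dedekindZetaCont F w * ∏' v : S, (1 - ((v : HeightOneSpectrum (𝓞 F)).residueCard : ℂ) ^ (-w))))
        1 ((dedekindZeta_residue F : ℂ) * ∏' v : S, (1 - ((v : HeightOneSpectrum (𝓞 F)).residueCard : ℂ) ^ (-(1 : ℂ)))) with hZdef
  obtain ⟨g, hg, -, hg_eq⟩ := exists_entire_eq_partialL hε hA h1 hS hur
  refine ⟨fun s => 1 / 2 * Z (2 * s) * g (2 * s - 1), ?_, fun s hs => ?_⟩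
  · have h2 : Differentiable ℂ (fun s : ℂ => 2 * s) := (differentiable_const _).mul differentiable_id
    exact ((differentiable_const _).mul (hZ.comp h2)).mul (hg.comp (h2.sub (differentiable_const _)))
  · obtain ⟨h2, h2m1, -, -⟩ := re_two_mul_shifts s
    have hw : 1 < (2 * s).re := by rw [h2]; linarith
    have hw' : 1 < (2 * s - 1).re := by rw [h2m1]; linarith
    show (s - 1 / 2) * (partialStandardL S (fun _ => {1}) (2 * s) *
        partialStandardL S (fun v => {ε.valueAtUniformizer v}) (2 * s - 1)) = 1 / 2 * Z (2 * s) * g (2 * s - 1)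
    rw [hZ_eq (2 * s) hw, ← hg_eq (2 * s - 1) hw']
    ring

/-! ## §5 MAIN: the scalar `a^S/b^S` continues to `Re s > 0` with at most a simple pole at `s = ½` -/

/-- **O41.6 — THE SIEGEL INTERTWINING SCALAR UNDER PARITY, `n = 2`: CONTINUATION TO `Re s > 0` WITH AT MOST A SIMPLE POLE AT `s = ½`.**
For a number field `F`, a unitary Hecke character `ε ≠ 1` of `F` trivial on the diagonal positive reals, and a finite set `S` of finite
places off which `ε` is unramified, there is a function `G` HOLOMORPHIC on the half-plane `{Re s > 0}` such that for `Re s > 1`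
  `(s − ½) · a^S(s)/b^S(s) = G(s)`,  `a^S(s) = ζ_F^S(2s)·L^S(2s−1, ε)`,  `b^S(s) = ζ_F^S(2s+1)·L^S(2s+2, ε)`
(Euler products, ★ `partialStandardL`).  Hence the global Gindikin–Karpelevich scalar `a^S/b^S` of the Siegel intertwining operator of `U(2,2)`
for a conjugate-symplectic `χ` (`χ⁰ = ε = ε_{L/L⁺}`, `F = L⁺`) continues meromorphically to `Re s > 0` as `G(s)/(s − ½)`: at most a simple
pole at `½` (from `ζ_F(2s)`), no pole at `s = 1` (`L(2s−1, ε)` is entire as `ε ≠ 1`), denominator zero-free (§3); `G = A/b^S`, `A` from §4.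
[cite: Tan1999, §3] [cite: Harris2007, (1.3.4) p. 92] [cite: NeukirchANT1999, Ch. VII Cor. (5.11)] [cite: Iwasawa2019, Thm. 3.1] -/
theorem exists_differentiableOn_sub_half_mul_scalar (hε : ε.IsUnitary) (hA : ∀ t : ℝ≥0ˣ, ε (posRealIdele F t) = 1) (h1 : ε ≠ 1)
    (hS : S.Finite) (hur : ∀ v ∉ S, ε.IsUnramifiedAt v) :
    ∃ G : ℂ → ℂ, DifferentiableOn ℂ G {s : ℂ | 0 < s.re} ∧ ∀ s : ℂ, 1 < s.re →
      (s - 1 / 2) *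
        ((partialStandardL S (fun _ => {1}) (2 * s) * partialStandardL S (fun v => {ε.valueAtUniformizer v}) (2 * s - 1)) /
          (partialStandardL S (fun _ => {1}) (2 * s + 1) * partialStandardL S (fun v => {ε.valueAtUniformizer v}) (2 * s + 2))) =
        G s := by
  obtain ⟨A, hA', hA_eq⟩ := exists_entire_sub_half_mul_a hε hA h1 hS hur
  refine ⟨fun s => A s /
      (partialStandardL S (fun _ => {1}) (2 * s + 1) * partialStandardL S (fun v => {ε.valueAtUniformizer v}) (2 * s + 2)),
    hA'.differentiableOn.div (differentiableOn_b hε) fun s hs => (hasProd_b hε hs).2, fun s hs => ?_⟩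
  show _ = A s / _
  rw [← hA_eq s hs]
  ring

/-! ## §6 The denominator on the CLOSED half-plane `Re s ≥ 0`: no zero, and the pole of `ζ_F(2s+1)` at `s = 0` -/

/-- **«`b^S ≠ 0` on `Re s ≥ 0`» (LEAD DEAL O41.6), HONEST FORM.**  `B(s) = ζ_F(2s+1)·E_S(2s+1)·L^S(2s+2, ε)` (`ζ_F =` ★ `dedekindZetaCont`,
`E_S(w) = ∏'_{v∈S}(1 − q_v^{−w})`) is (i) holomorphic on `{Re s > −½} ∖ {0}`, (ii) `= b^S` on `{Re s > 0}`, (iii) `≠ 0` for `Re s ≥ 0`, `s ≠ 0`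
(on `Re s = 0`: Landau's `ζ_F(1 + it) ≠ 0`, ★ `dedekindZetaCont_mul_thinEulerFactor_ne_zero`, times the Euler product `L^S(2 + it, ε) ≠ 0`),
and (iv) `s·B(s) → r = ½ ρ_F E_S(1) L^S(2, ε) ≠ 0` on `𝓝[≠] 0` (the simple pole of `ζ_F(2s+1)`; so `1/b^S` is holomorphic near `Re s ≥ 0` with
its only zero at `s = 0`). [cite: NeukirchANT1999, Ch. VII Cor. (5.11)] [cite: Iwasawa2019, Ch. 4 §4.2 Prop. 4.4] -/
theorem exists_continuation_b_boundary (hε : ε.IsUnitary) (hS : S.Finite) :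
    ∃ B : ℂ → ℂ, DifferentiableOn ℂ B ({s : ℂ | -(1 / 2 : ℝ) < s.re} \ {0}) ∧
      (∀ s : ℂ, 0 < s.re → B s =
        partialStandardL S (fun _ => {1}) (2 * s + 1) * partialStandardL S (fun v => {ε.valueAtUniformizer v}) (2 * s + 2)) ∧
      (∀ s : ℂ, 0 ≤ s.re → s ≠ 0 → B s ≠ 0) ∧
      ∃ r : ℂ, r ≠ 0 ∧ Tendsto (fun s : ℂ => s * B s) (𝓝[≠] 0) (𝓝 r) := by
  have hS0 := summable_residueCard_rpow_neg_of_finite hS (0 : ℝ)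
  set ZE : ℂ → ℂ := fun w : ℂ =>
    dedekindZetaCont F w * ∏' v : S, (1 - ((v : HeightOneSpectrum (𝓞 F)).residueCard : ℂ) ^ (-w)) with hZE
  set LS : ℂ → ℂ := partialStandardL S (fun v => {ε.valueAtUniformizer v}) with hLS
  have haff : Differentiable ℂ (fun s : ℂ => 2 * s + 1) := ((differentiable_const _).mul differentiable_id).add (differentiable_const _)
  have haff' : Differentiable ℂ (fun s : ℂ => 2 * s + 2) := ((differentiable_const _).mul differentiable_id).add (differentiable_const _)
  -- `L^S(2s+2, ε)` is holomorphic on `Re s > −½`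
  have hLd : DifferentiableOn ℂ (fun s : ℂ => LS (2 * s + 2)) {s : ℂ | -(1 / 2 : ℝ) < s.re} :=
    (differentiableOn_partialStandardL_singleton _ (norm_valueAtUniformizer_le_one hε S)).comp haff'.differentiableOn
      fun s hs => by
        have hs' : -(1 / 2 : ℝ) < s.re := hs
        show 1 < (2 * s + 2).re
        rw [(re_two_mul_shifts s).2.2.2]; linarith
  refine ⟨fun s => ZE (2 * s + 1) * LS (2 * s + 2), ?_, fun s hs => ?_, fun s hs hs0 => ?_, ?_⟩
  · -- (i) holomorphy on `{Re s > −½} ∖ {0}`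
    have hZd : DifferentiableOn ℂ (fun s : ℂ => ZE (2 * s + 1)) ({s : ℂ | -(1 / 2 : ℝ) < s.re} \ {0}) :=
      (differentiableOn_dedekindZetaCont_mul_thinEulerFactor hS0).comp haff.differentiableOn fun s hs => by
        refine ⟨?_, fun h => hs.2 ?_⟩
        · have hs' : -(1 / 2 : ℝ) < s.re := hs.1
          show (0 : ℝ) < (2 * s + 1).re
          rw [(re_two_mul_shifts s).2.2.1]; linarith
        · have h' : (2 * s + 1 : ℂ) = 1 := h
          have : (2 : ℂ) * s = 0 := by linear_combination h'
          simpa using this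
    exact hZd.mul (hLd.mono fun s hs => hs.1)
  · -- (ii) agreement with `b^S` on `Re s > 0`
    have hw : 1 < (2 * s + 1).re := by rw [(re_two_mul_shifts s).2.2.1]; linarith
    show ZE (2 * s + 1) * LS (2 * s + 2) = _
    rw [hZE, hLS, partialDedekindZeta_eq_dedekindZetaCont_mul hS0 hw (zero_lt_one.trans hw)]
  · -- (iii) no zero on `Re s ≥ 0`, `s ≠ 0`
    have hw : 1 ≤ (2 * s + 1).re := by rw [(re_two_mul_shifts s).2.2.1]; linarith
    have hw1 : (2 * s + 1 : ℂ) ≠ 1 := fun h => hs0 (by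
      have : (2 : ℂ) * s = 0 := by linear_combination h
      simpa using this)
    have hw2 : 1 < (2 * s + 2).re := by rw [(re_two_mul_shifts s).2.2.2]; linarith
    exact mul_ne_zero (dedekindZetaCont_mul_thinEulerFactor_ne_zero hS0 zero_lt_one hw hw1)
      (hasProd_partialStandardL_singleton _ (norm_valueAtUniformizer_le_one hε S) hw2).2
  · -- (iv) the pole at `s = 0`
    set r₀ : ℂ := (dedekindZeta_residue F : ℂ) *
      ∏' v : S, (1 - ((v : HeightOneSpectrum (𝓞 F)).residueCard : ℂ) ^ (-(1 : ℂ))) with hr₀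
    have hr₀0 : r₀ ≠ 0 := residue_mul_thinEulerFactor_ne_zero hS0 zero_lt_one
    have hL2 : LS 2 ≠ 0 := (hasProd_partialStandardL_singleton _ (norm_valueAtUniformizer_le_one hε S) (s := 2) (by norm_num)).2
    refine ⟨1 / 2 * r₀ * LS 2, mul_ne_zero (mul_ne_zero (by norm_num) hr₀0) hL2, ?_⟩
    -- `s ↦ 2s + 1` maps `𝓝[≠] 0` into `𝓝[≠] 1`
    have hφ : Tendsto (fun s : ℂ => 2 * s + 1) (𝓝[≠] (0 : ℂ)) (𝓝[≠] (1 : ℂ)) := by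
      refine tendsto_nhdsWithin_of_tendsto_nhds_of_eventually_within _ ?_ ?_
      · have h := (haff.continuous.tendsto (0 : ℂ)).mono_left (nhdsWithin_le_nhds (s := ({0}ᶜ : Set ℂ)))
        simpa using h
      · filter_upwards [self_mem_nhdsWithin] with s hs
        intro h
        have h' : (2 * s + 1 : ℂ) = 1 := h
        have : (2 : ℂ) * s = 0 := by linear_combination h'
        exact hs (by simpa using this)
    have hZlim : Tendsto (fun s : ℂ => (2 * s + 1 - 1) * ZE (2 * s + 1)) (𝓝[≠] (0 : ℂ)) (𝓝 r₀) :=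
      (tendsto_sub_one_mul_dedekindZetaCont_mul_thinEulerFactor hS0 zero_lt_one).comp hφ
    have hLlim : Tendsto (fun s : ℂ => LS (2 * s + 2)) (𝓝[≠] (0 : ℂ)) (𝓝 (LS 2)) := by
      have hmem : (0 : ℂ) ∈ {s : ℂ | -(1 / 2 : ℝ) < s.re} := by show -(1 / 2 : ℝ) < (0 : ℂ).re; norm_num
      have hc : ContinuousAt (fun s : ℂ => LS (2 * s + 2)) 0 :=
        (hLd.differentiableAt ((isOpen_lt continuous_const continuous_re).mem_nhds hmem)).continuousAt
      have h := hc.tendsto.mono_left (nhdsWithin_le_nhds (s := ({0}ᶜ : Set ℂ)))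
      simpa using h
    have hlim := (hZlim.mul hLlim).const_mul (1 / 2 : ℂ)
    have hval : (1 / 2 : ℂ) * (r₀ * LS 2) = 1 / 2 * r₀ * LS 2 := by ring
    rw [hval] at hlim
    refine hlim.congr fun s => ?_
    show 1 / 2 * ((2 * s + 1 - 1) * ZE (2 * s + 1) * LS (2 * s + 2)) = s * (ZE (2 * s + 1) * LS (2 * s + 2))
    ring

end GL1

/-! ## §7 The CM corollary: `ε = ε_{L/L⁺}`, `F = L⁺` -/

section CM

variable (L : Type) [Field L] [NumberField L] [IsCMField L]

/-- **O41.6 AT THE K2_Liu FRAME: the intertwining scalar for `χ⁰ = ε_{L/L⁺}`.**  For a CM field `L` with maximal totally real subfield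
`L⁺` and its quadratic character `ε = ε_{L/L⁺}` (★ `quadraticHeckeCharCM L`, a Hecke character of `L⁺`), and a finite set `S` of finite
places of `L⁺` off which `ε` is unramified (so `S` contains the places ramified in `L/L⁺`; ★
`isUnramifiedAt_quadraticHeckeCharCM_of_isUnramifiedIn` discharges the rest), there is `G` holomorphic on `{Re s > 0}` with
`(s − ½)·[ζ_{L⁺}^S(2s) L^S(2s−1, ε)] / [ζ_{L⁺}^S(2s+1) L^S(2s+2, ε)] = G(s)` for `Re s > 1`; `ε ≠ 1` (★ `quadraticHeckeCharCM_ne_one`), finite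
order (★ `isFiniteOrder_quadraticHeckeCharCM`) ⇒ unitary, trivial on `ℝ_{>0}` (★ `map_posRealIdele_of_isFiniteOrder`).  This is the scalar
`a^S/b^S` of `M(s)` on `I_Δ(s, χ)`, `H = U(2,2)`, for every conjugate-symplectic `χ` (`χ|_{𝔸_{L⁺}^×} = ε`) of the K2_Liu frame.
[cite: Tan1999, §3] [cite: Harris2007, (1.3.4) p. 92] [cite: Liu2011, §2A (2-2)] -/
theorem exists_differentiableOn_sub_half_mul_scalar_cm {S : Set (HeightOneSpectrum (𝓞 ↥(maximalRealSubfield L)))}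
    (hS : S.Finite) (hur : ∀ v ∉ S, (quadraticHeckeCharCM L).IsUnramifiedAt v) :
    ∃ G : ℂ → ℂ, DifferentiableOn ℂ G {s : ℂ | 0 < s.re} ∧ ∀ s : ℂ, 1 < s.re →
      (s - 1 / 2) *
        ((partialStandardL S (fun _ => {1}) (2 * s) *
            partialStandardL S (fun v => {(quadraticHeckeCharCM L).valueAtUniformizer v}) (2 * s - 1)) /
          (partialStandardL S (fun _ => {1}) (2 * s + 1) *
            partialStandardL S (fun v => {(quadraticHeckeCharCM L).valueAtUniformizer v}) (2 * s + 2))) =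
        G s := by
  have hfin : (quadraticHeckeCharCM L).IsFiniteOrder :=
    Literature.RepresentationTheory.HarrisKudlaSweet1996.isFiniteOrder_quadraticHeckeCharCM (L := L)
  exact exists_differentiableOn_sub_half_mul_scalar hfin.isUnitary
    (fun t => HeckeCharacter.map_posRealIdele_of_isFiniteOrder hfin t) (quadraticHeckeCharCM_ne_one L) hS hur

/-- **The denominator at the K2_Liu frame**: §6 for `ε = ε_{L/L⁺}` — `b^S = ζ_{L⁺}^S(2s+1)·L^S(2s+2, ε_{L/L⁺})` continues to
`{Re s > −½} ∖ {0}`, has no zero on `Re s ≥ 0`, `s ≠ 0`, and a simple pole at `s = 0`. [cite: NeukirchANT1999, Ch. VII Cor. (5.11)]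
[cite: Iwasawa2019, Ch. 4 §4.2 Prop. 4.4] -/
theorem exists_continuation_b_boundary_cm {S : Set (HeightOneSpectrum (𝓞 ↥(maximalRealSubfield L)))} (hS : S.Finite) :
    ∃ B : ℂ → ℂ, DifferentiableOn ℂ B ({s : ℂ | -(1 / 2 : ℝ) < s.re} \ {0}) ∧
      (∀ s : ℂ, 0 < s.re → B s =
        partialStandardL S (fun _ => {1}) (2 * s + 1) *
          partialStandardL S (fun v => {(quadraticHeckeCharCM L).valueAtUniformizer v}) (2 * s + 2)) ∧
      (∀ s : ℂ, 0 ≤ s.re → s ≠ 0 → B s ≠ 0) ∧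
      ∃ r : ℂ, r ≠ 0 ∧ Tendsto (fun s : ℂ => s * B s) (𝓝[≠] 0) (𝓝 r) :=
  exists_continuation_b_boundary
    (Literature.RepresentationTheory.HarrisKudlaSweet1996.isFiniteOrder_quadraticHeckeCharCM (L := L)).isUnitary hS

end CM

end Summit.HodgeConjecture.HodgeConjecture.Cruxes.HLiu418.K2LiuSiegelIntertwiningScalarGL1

end
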